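import Summits.ResolutionOfSingularities.ResolutionOfSingularities.Theorems.WeightedInvariantIota3CriticalNonSolvable
import Summits.ResolutionOfSingularities.ResolutionOfSingularities.Theorems.WeightedInvariantIota3JSigmaDominanceGeneric
import HarnessLib

/-!
# Tools for reading the residue hres₃ in the critical graded ring: small additions to the initial-form calculus and weight
# bookkeeping for the weights `(r₂, j r₂, j r₁)` (door `HypersurfaceCentreConstruction`, stmt-ResolutionOfSingularities-19897)

Helper for `stub_keyRungGrHomLE_three` (def-free, `--supports 19897`); used by …Iota3ResidueOfLemmaC.

* `isInForm_X`, `isInForm_one`, `isInForm_pow`, `isInForm_neg`, `isInForm_sub`, `isInForm_finset_sum`, `mem_succ_of_isInForm_zero` —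
  graded-ring bookkeeping for `Literature…IsInForm` (variables, powers, differences, finite sums; an element with initial form `0`
  lies one step deeper);
* `exponent_of_weight_critical₂` — a weight-`j r₂` exponent is `X₀^j` or `X₁` (`0 < r₂ < r₁`, `1 ≤ j`);
* `pure_degree_gt` — a pure exponent (`e₀ = 0`, `r₁e₂ + r₂e₁ = r₁ν`) other than `X₂^ν` has flag degree `> ν`;
* `flagContactFiltration_le_pow_of_lt₂` — `F_{(Q;R₁,R₂)}(n) ≤ 𝔪ᵏ` when `R₁(k−1) < n` (general triple; the tree's version has `R₁ = R₂`).

[OURS · L1 W4.3 · (o70-b)/(Δ12); AI work, weaker than expert review; nothing here is a statement of the manuscript under review.]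
-/

noncomputable section

open IsLocalRing Literature.AlgebraicGeometry.Resolution MvPolynomial
open Summit.ResolutionOfSingularities.ResolutionOfSingularities.Theorems

set_option linter.dupNamespace false -- mandated namespace of this single-conjunct summit

namespace Summit.ResolutionOfSingularities.ResolutionOfSingularities.Cruxes.HypersurfaceCentreConstruction.LocalEngine

namespace Iota3

/-! ## §1 Small additions to the initial-form calculus -/

section InForm

variable {R : Type} [CommRing R] [IsLocalRing R]

/-- A generator is its own variable: `in_{w i}(c i) = X i`. [folklore] -/
theorem isInForm_X (c : Fin 3 → R) (w : Fin 3 → ℕ) (i : Fin 3) : IsInForm c w (w i) (c i) (X i) :=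
  ⟨X i, isWeightedHomogeneous_X _ _ _, by rw [map_X], by rw [eval_X, sub_self]; exact zero_mem _⟩

/-- `in_0(1) = 1`. [folklore] -/
theorem isInForm_one (c : Fin 3 → R) (w : Fin 3 → ℕ) : IsInForm c w 0 (1 : R) 1 :=
  ⟨1, isWeightedHomogeneous_one _ _, by rw [map_one], by rw [map_one, sub_self]; exact zero_mem _⟩

/-- Powers: `in_{kn}(f^k) = in_n(f)^k`. [cite: CossartJannsenSaito2020, Lemma 8.3] -/
theorem isInForm_pow (c : Fin 3 → R) {w : Fin 3 → ℕ} {n : ℕ} {f : R} {P : MvPolynomial (Fin 3) (ResidueField R)}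
    (hP : IsInForm c w n f P) : ∀ k : ℕ, IsInForm c w (k * n) (f ^ k) (P ^ k)
  | 0 => by rw [zero_mul, pow_zero, pow_zero]; exact isInForm_one c w
  | k + 1 => by
    rw [Nat.succ_mul, pow_succ, pow_succ]
    exact (isInForm_pow c hP k).mul c hP

/-- Negation. [folklore] -/
theorem isInForm_neg (c : Fin 3 → R) {w : Fin 3 → ℕ} {n : ℕ} {f : R} {P : MvPolynomial (Fin 3) (ResidueField R)}
    (hP : IsInForm c w n f P) : IsInForm c w n (-f) (-P) := by
  have h := hP.smul c (-1)
  rwa [map_neg, map_one, map_neg, map_one, neg_one_mul, neg_one_mul] at h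

/-- Differences. [folklore] -/
theorem isInForm_sub (c : Fin 3 → R) {w : Fin 3 → ℕ} {n : ℕ} {f g : R} {P Q : MvPolynomial (Fin 3) (ResidueField R)}
    (hP : IsInForm c w n f P) (hQ : IsInForm c w n g Q) : IsInForm c w n (f - g) (P - Q) := by
  simp only [sub_eq_add_neg]
  exact IsInForm.add c hP (isInForm_neg c hQ)

/-- Finite sums. [folklore] -/
theorem isInForm_finset_sum (c : Fin 3 → R) {w : Fin 3 → ℕ} {n : ℕ} {ι : Type} (s : Finset ι) {f : ι → R}
    {P : ι → MvPolynomial (Fin 3) (ResidueField R)} (h : ∀ i ∈ s, IsInForm c w n (f i) (P i)) :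
    IsInForm c w n (∑ i ∈ s, f i) (∑ i ∈ s, P i) := by
  classical
  induction s using Finset.induction_on with
  | empty => rw [Finset.sum_empty, Finset.sum_empty]; exact isInForm_zero_of_mem_succ c (zero_mem _)
  | insert a s ha ih =>
    rw [Finset.sum_insert ha, Finset.sum_insert ha]
    exact (h a (Finset.mem_insert_self a s)).add c (ih fun i hi => h i (Finset.mem_insert_of_mem hi))

/-- An element with initial form `0` in degree `n` lies in `F_{n+1}` (positive weights, `(c) = 𝔪`). [folklore] -/
theorem mem_succ_of_isInForm_zero (c : Fin 3 → R) (hgen : Ideal.span (Set.range c) = maximalIdeal R) {w : Fin 3 → ℕ}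
    (hw : ∀ i, 0 < w i) {n : ℕ} {f : R} (h : IsInForm c w n f 0) : f ∈ weightedIdealW c w (n + 1) := by
  obtain ⟨F, hF, hF0, hrem⟩ := h
  have h1 := eval_mem_succ_of_coeff_mem c hgen hw hF ((map_residue_eq_zero_iff F).mp hF0)
  have : f = (f - eval c F) + eval c F := by ring
  rw [this]; exact Ideal.add_mem _ hrem h1

end InForm

/-! ## §2 Weight bookkeeping in the critical graded ring -/

/-- A weight-`j r₂` exponent for the weights `(r₂, j r₂, j r₁)` (`0 < r₂ < r₁`, `1 ≤ j`) is `X₀^j` or `X₁`. [folklore] -/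
theorem exponent_of_weight_critical₂ {r₁ r₂ j : ℕ} (hr₂ : 0 < r₂) (hr : r₂ < r₁) (hj : 1 ≤ j) {d : Fin 3 →₀ ℕ}
    (hd : r₂ * d 0 + j * r₂ * d 1 + j * r₁ * d 2 = j * r₂) : d = Finsupp.single 0 j ∨ d = Finsupp.single 1 1 := by
  have hjr : j * r₂ < j * r₁ := Nat.mul_lt_mul_of_pos_left hr hj
  have hd2 : d 2 = 0 := by
    by_contra h
    have h1 : 1 ≤ d 2 := Nat.one_le_iff_ne_zero.mpr h
    have := Nat.mul_le_mul_left (j * r₁) h1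
    rw [mul_one] at this
    omega
  rw [hd2, mul_zero, add_zero] at hd
  rcases Nat.eq_zero_or_pos (d 1) with h1 | h1
  · rw [h1, mul_zero, add_zero] at hd
    left
    have hd0 : d 0 = j := by
      have : r₂ * d 0 = r₂ * j := by rw [hd, mul_comm]
      exact Nat.eq_of_mul_eq_mul_left hr₂ this
    ext i; fin_cases i <;> simp [hd0, h1, hd2]
  · right
    have hd1 : d 1 = 1 := by
      by_contra hne
      have h2 : 2 ≤ d 1 := by omega
      have := Nat.mul_le_mul_left (j * r₂) h2
      have hpos : 0 < j * r₂ := Nat.mul_pos hj hr₂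
      omega
    have hd0 : d 0 = 0 := by
      rw [hd1, mul_one] at hd
      have : r₂ * d 0 = 0 := by omega
      exact (Nat.mul_eq_zero.mp this).resolve_left (by omega)
    ext i; fin_cases i <;> simp [hd0, hd1, hd2]

/-- A pure exponent other than `Y^ν` has total flag degree `> ν` (`0 < r₂ < r₁`). [folklore] -/
theorem pure_degree_gt {r₁ r₂ ν : ℕ} (hr₂ : 0 < r₂) (hr : r₂ < r₁) {e : Fin 3 →₀ ℕ} (he0 : e 0 = 0)
    (hpure : r₁ * e 2 + r₂ * e 1 = r₁ * ν) (hne : e ≠ Finsupp.single 2 ν) : ν + 1 ≤ e 1 + e 2 := by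
  rcases Nat.eq_zero_or_pos (e 1) with h1 | h1
  · exfalso
    rw [h1, mul_zero, add_zero] at hpure
    have he2 : e 2 = ν := Nat.eq_of_mul_eq_mul_left (lt_trans hr₂ hr) hpure
    exact hne (by ext i; fin_cases i <;> simp [he0, h1, he2])
  · have hlt : e 2 < ν := by
      by_contra h
      have : ν ≤ e 2 := by omega
      have := Nat.mul_le_mul_left r₁ this
      nlinarith
    obtain ⟨d, hd⟩ := Nat.exists_eq_add_of_lt hlt
    -- `r₂ e₁ = r₁ (d + 1) > r₂ (d + 1)`
    have h2 : r₂ * e 1 = r₁ * (d + 1) := by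
      have : r₁ * ν = r₁ * e 2 + r₁ * (d + 1) := by rw [hd]; ring
      omega
    have h3 : r₂ * (d + 1) < r₂ * e 1 := by
      rw [h2]; exact Nat.mul_lt_mul_of_pos_right hr (by omega)
    have h4 : d + 1 < e 1 := Nat.lt_of_mul_lt_mul_left h3
    omega

/-- `F_{(Q;R₁,R₂)}(n) ≤ 𝔪ᵏ` as soon as `R₁(k − 1) < n` (spelled `R₁ k < n + R₁`) for `g₁, g₂ ∈ 𝔪`, `0 < Q`, `R₂ ≤ R₁`, `Q ≤ R₁`. [folklore] -/
theorem flagContactFiltration_le_pow_of_lt₂ {S : Type} [CommRing S] [IsLocalRing S] {g₁ g₂ : S} (hg₁ : g₁ ∈ maximalIdeal S)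
    (hg₂ : g₂ ∈ maximalIdeal S) {Q R₁ R₂ n k : ℕ} (hQ : 0 < Q) (hQ₁ : Q ≤ R₁) (hR : R₂ ≤ R₁) (hk : R₁ * k < n + R₁) :
    flagContactFiltration g₁ g₂ Q R₁ R₂ n ≤ maximalIdeal S ^ k := by
  rw [flagContactFiltration_def]
  refine iSup_le fun α => iSup_le fun β => (flagPiece_le_pow hg₁ hg₂ α β _).trans (Ideal.pow_le_pow_right ?_)
  set e := (n - R₁ * α - R₂ * β + Q - 1) / Q with he
  have hn := le_mul_pieceExponent hQ n R₁ R₂ α β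
  rw [← he] at hn
  have h1 : n ≤ R₁ * (α + β + e) := by nlinarith
  have h2 : R₁ * k < R₁ * (α + β + e + 1) := by nlinarith
  have := Nat.lt_of_mul_lt_mul_left h2
  omega

end Iota3

end Summit.ResolutionOfSingularities.ResolutionOfSingularities.Cruxes.HypersurfaceCentreConstruction.LocalEngine

end
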